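import Summits.ABC.IUTFork.Cor312HullFrameReal
import HarnessLib

/-!
# [IUTchIII] Corollary 3.12, statement — assembling a `Cor312.Setting` over REAL packets

Record-only file (D-0012) of the abc-iut cell (Cor. 3.12 crew, wave 2, seat abc-iut-c312-7; claim W2-B; built at
the request of seat c312-5, INBOX 2026-08-25T20:26:35Z); TAKES NO SIDE. `Cor312Statement.lean` states [IUTchIII]
Cor. 3.12 (kurims `paper:url-4b091feeb646` p. 173 l. 41 – p. 174 l. 19) over a `Cor312.Setting S`; this file is
the CONSTRUCTOR `Cor312.Setting.ofComparison` that assembles such a setting over ANY typed situation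
`S : Thm311.Situation T` (c312-1; for the real carriers: c312-5's `Thm311.Real.situation` /
`Situation.ofShells (Real.logShellsOfInitial D …)`) from:

* COMPARISON MAPS `e j v_ℚ : 𝓘^ℚ(^{S^±_{j+1}};𝒟^⊢_{v_ℚ}) → ⊕_{i ∈ J j v_ℚ} K_i` from the (algebraic) tensor packets
  to finite direct sums of nonarchimedean local fields ([IUTchIII] Prop. 3.1 (i): the packet "may be
  regarded as an inductive limit of direct sums of ind-topological fields"; Prop. 3.2 (i); Dupuy–Hilado §4:
  `𝕃_p^{(j)} = ⊕_{v⃗} K_{v⃗}`) — a BINDER (owner: L6-t5's Mathlib-gap file O1 `PiTensorProductField` for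
  `⊗_i K_{v_i} ≅ ⊕ fields`; c312-5 `Real.packet1EquivPi` at 1-packets);
* the HULL FRAME := the REAL one pulled back, `HullFrame.ofComparison (K j v_ℚ) (e j v_ℚ)` (Cor312HullFrameReal,
  over campaign-S `Literature.IUT.LogVolume.HolomorphicHull`) — DEFINED, no binder;
* the q-PILOT IMAGE := the preimage of a genuine hull-set `λ_q·𝒪_L` (`LogVolume.hullSet`) with nonzero centre
  `qCentre` ([IUTchIII] Rmk. 3.9.5 (ix) (cQ3): pilot objects give arithmetic line bundles = hull-sets;
  Dupuy–Hilado §3.4 `O_𝕃(−P_q)`) — so `qRegion_mem` is PROVED, not assumed;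
* the Θ-PILOT IMAGES := preimages of regions `thetaBox m` of the real packet (binder; owner c312-3
  `Literature.IUT.LogVolume.IndPacketModel` / `Ind3Datum`, Dupuy–Hilado §4.10 `O_𝕃(−P_Θ)^{Ind3}`, and c312-1 C/G);
* `hul_adm` reduced to ONE hypothesis `hadm`: "hull-sets of the real packet are admissible regions of (i) (a)"
  ([IUTchIII] Prop. 3.9 (i): `𝕄(−)` ∋ compact open subsets; `λ·𝒪_L` is compact open) — dischargeable once the
  situation's `Adm` is the concrete one (c312-6 `Cor312Vol.Adm`); `qSupport_finite` = hypothesis `hfin`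
  (Prop. 3.9 (iii); Rmk. 3.9.7 (i)); the lattice / Prop. 3.7 / q-pilot SIGNATURE data stay binders (L5-t4,
  L6-t3, L6-t4 owners) — they are context for the statement, which reads only the regions.
PROVED bookkeeping: `ofComparison_qRegion` / `_thetaRegion` / `_frame` (`rfl`), `ofComparison_qRegion_mem_hul`.
The binder list of `Setting.ofComparison` IS the residual list of `HOME/plan/C312-RESIDUALS.md` §1a in Lean form.
[claim: Mochizuki2012, status: disputed] for the quoted definitions. Deliberately NOT here: the specialisation to
c312-5's `Real.situation` (one line once Thm311Real2 p406810 lands; c312-5's `Cor312Real.lean`), log-volumes,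
any judgement.
-/

noncomputable section

namespace Summit.ABC.IUTFork.Cor312

open Thm311 Literature.IUT.LogThetaLattice

namespace Setting

variable {T : ThetaIndex} (S : Situation T)

/-- The REAL-PACKET PIECES of a Cor. 3.12 setting over the situation `S`: per `(j, v_ℚ)` a finite index
type `J j v_ℚ` of summand fields `K j v_ℚ i` (nonarchimedean local fields, campaign-S norm presentation)
with the comparison map `e j v_ℚ` from the tensor packet; the Θ-pilot regions `thetaBox m` of the real
packet per lattice position `(n, m)` and object; the nonzero centre `qCentre` of the q-pilot hull-set per
object of `†𝒞^⊩_△`. [claim: Mochizuki2012, status: disputed] -/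
structure RealPieces (ObLgp ObΔ : Type) : Type 1 where
  /-- summand index of the completed packet at `(j, v_ℚ)` (tuples `v⃗`, Dupuy–Hilado §4) -/
  J : T.Label → T.VQ → Type
  /-- … is finite -/
  [instFintype : ∀ j vQ, Fintype (J j vQ)]
  /-- the summand fields `K_{v⃗}` -/
  K : ∀ j vQ, J j vQ → Type
  /-- … are nontrivially normed fields -/
  [instField : ∀ j vQ i, NontriviallyNormedField (K j vQ i)]
  /-- … ultrametric -/
  [instUltra : ∀ j vQ i, IsUltrametricDist (K j vQ i)]
  /-- … locally compact (proper) -/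
  [instProper : ∀ j vQ i, ProperSpace (K j vQ i)]
  /-- the comparison map packet → ⊕ of fields ([IUTchIII] Prop. 3.1 (i), 3.2 (i)) -/
  e : ∀ j vQ, S.L.Packet j vQ → ∀ i, K j vQ i
  /-- the Θ-pilot region of the real packet determined by an object at lattice position `(n, m)` -/
  thetaBox : ℤ → ObLgp → ∀ j vQ, Set (∀ i, K j vQ i)
  /-- the centre `λ_q` of the q-pilot hull-set `λ_q·𝒪_L` determined by an object of `†𝒞^⊩_△` -/
  qCentre : ObΔ → ∀ j vQ, ∀ i, K j vQ i

attribute [instance] RealPieces.instFintype RealPieces.instField RealPieces.instUltra RealPieces.instProper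

variable {S}

/-- **Assembling a setting over real packets.** Given the context data (lattice, Prop. 3.7 output, q-pilot
data — binders), real-packet pieces `R`, and the two admissibility/finiteness hypotheses, the
`Cor312.Setting S` whose hull frames are the REAL frames pulled back along the comparison maps, whose
q-pilot image is the preimage of the hull-set `λ_q·𝒪_L`, and whose Θ-pilot images are the preimages of
`R.thetaBox`. [claim: Mochizuki2012, status: disputed] -/
def ofComparison (n : ℤ) {HT : Type} {LogLink : HT → HT → Type} {IsFull : ∀ {s t : HT}, LogLink s t → Prop}
    (lat : LGPGaussianLogThetaLattice LogLink IsFull)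
    {Frd : Type} {IsoF : Frd → Frd → Type} {Ob : Frd → Type} {realify : Frd → Frd} {Strip : Type}
    {IsoS : Strip → Strip → Type} {M : ∀ v : T.V, v ∈ T.Vbad → Type} [∀ v h, Monoid (M v h)]
    (sig : GlobalLGPFrobenioidSignature T.lstar T.V (· ∈ T.Vbad) Frd IsoF Ob realify Strip IsoS M)
    (split : SplittingMonoids M) {ObΔ : Type} {N : ∀ v : T.V, v ∈ T.Vbad → Type} [∀ v h, Monoid (N v h)]
    (qData : QPilotData ObΔ N) (R : RealPieces S (Ob sig.Clgp) ObΔ)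
    (hq : ∀ j vQ i, R.qCentre (qPilotObject qData) j vQ i ≠ 0)
    (hadm : ∀ j vQ (H : Set (∀ i, R.K j vQ i)), Literature.IUT.LogVolume.IsHullSet (R.K j vQ) H →
      (S.D n).Adm j vQ (R.e j vQ ⁻¹' H))
    (hfin : ∀ j : T.Label, (Function.support fun vQ => (S.D n).logvol j vQ
      (R.e j vQ ⁻¹' Literature.IUT.LogVolume.hullSet (R.K j vQ) (R.qCentre (qPilotObject qData) j vQ))).Finite) :
    Setting S where
  n := n
  HT := HT
  LogLink := LogLink
  IsFull := IsFull
  lattice := lat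
  Frd := Frd
  IsoF := IsoF
  Ob := Ob
  realify := realify
  Strip := Strip
  IsoS := IsoS
  M := M
  sig := sig
  split := split
  ObΔ := ObΔ
  N := N
  qData := qData
  frame j vQ := HullFrame.ofComparison (R.K j vQ) (R.e j vQ)
  hul_adm j vQ H hH := by
    obtain ⟨H', hH', rfl⟩ := hH
    exact hadm j vQ H' hH'
  thetaRegionOf m o j vQ := R.e j vQ ⁻¹' R.thetaBox m o j vQ
  qRegionOf o j vQ := R.e j vQ ⁻¹' Literature.IUT.LogVolume.hullSet (R.K j vQ) (R.qCentre o j vQ)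
  qRegion_mem j vQ := ⟨_, ⟨R.qCentre (qPilotObject qData) j vQ, hq j vQ, rfl⟩, rfl⟩
  qSupport_finite := hfin

section

variable (n : ℤ) {HT : Type} {LogLink : HT → HT → Type} {IsFull : ∀ {s t : HT}, LogLink s t → Prop}
  (lat : LGPGaussianLogThetaLattice LogLink IsFull)
  {Frd : Type} {IsoF : Frd → Frd → Type} {Ob : Frd → Type} {realify : Frd → Frd} {Strip : Type}
  {IsoS : Strip → Strip → Type} {M : ∀ v : T.V, v ∈ T.Vbad → Type} [∀ v h, Monoid (M v h)]
  (sig : GlobalLGPFrobenioidSignature T.lstar T.V (· ∈ T.Vbad) Frd IsoF Ob realify Strip IsoS M)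
  (split : SplittingMonoids M) {ObΔ : Type} {N : ∀ v : T.V, v ∈ T.Vbad → Type} [∀ v h, Monoid (N v h)]
  (qData : QPilotData ObΔ N) (R : RealPieces S (Ob sig.Clgp) ObΔ)
  (hq : ∀ j vQ i, R.qCentre (qPilotObject qData) j vQ i ≠ 0)
  (hadm : ∀ j vQ (H : Set (∀ i, R.K j vQ i)), Literature.IUT.LogVolume.IsHullSet (R.K j vQ) H →
    (S.D n).Adm j vQ (R.e j vQ ⁻¹' H))
  (hfin : ∀ j : T.Label, (Function.support fun vQ => (S.D n).logvol j vQ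
    (R.e j vQ ⁻¹' Literature.IUT.LogVolume.hullSet (R.K j vQ) (R.qCentre (qPilotObject qData) j vQ))).Finite)

/-- The assembled setting's hull frame at `(j, v_ℚ)` IS the real frame pulled back along `e`. [folklore] -/
theorem ofComparison_frame (j : T.Label) (vQ : T.VQ) :
    (ofComparison n lat sig split qData R hq hadm hfin).frame j vQ = HullFrame.ofComparison (R.K j vQ) (R.e j vQ) :=
  rfl

/-- The assembled setting's q-pilot image IS the preimage of the hull-set `λ_q·𝒪_L`. [folklore] -/
theorem ofComparison_qRegion (j : T.Label) (vQ : T.VQ) :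
    (ofComparison n lat sig split qData R hq hadm hfin).qRegion j vQ =
      R.e j vQ ⁻¹' Literature.IUT.LogVolume.hullSet (R.K j vQ) (R.qCentre (qPilotObject qData) j vQ) :=
  rfl

/-- The assembled setting's Θ-pilot image at `m` IS the preimage of `thetaBox m` at the Θ-pilot object.
[folklore] -/
theorem ofComparison_thetaRegion (m : ℤ) (j : T.Label) (vQ : T.VQ) :
    (ofComparison n lat sig split qData R hq hadm hfin).thetaRegion m j vQ =
      R.e j vQ ⁻¹' R.thetaBox m (thetaPilotObject sig split) j vQ :=
  rfl

/-- In the assembled setting the q-pilot image is a hull-set of the (pulled-back, real) frame — PROVED,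
not assumed ([IUTchIII] Rmk. 3.9.5 (ix) (cQ3)). [folklore] -/
theorem ofComparison_qRegion_mem_hul (j : T.Label) (vQ : T.VQ) :
    (ofComparison n lat sig split qData R hq hadm hfin).qRegion j vQ ∈
      ((ofComparison n lat sig split qData R hq hadm hfin).frame j vQ).Hul :=
  (ofComparison n lat sig split qData R hq hadm hfin).qRegion_mem j vQ

/-- In the assembled setting, the image under `e` of any union of possible images admits a hull as soon
as it is bounded and nondegenerate in the real packet — i.e. `HullDefined` is read on the REAL packet
(`Bornology.IsBounded`, `LogVolume.IsNondegenerate`). [folklore] -/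
theorem ofComparison_hullDefined_iff (j : T.Label) (vQ : T.VQ) :
    (ofComparison n lat sig split qData R hq hadm hfin).HullDefined j vQ ↔
      Bornology.IsBounded (R.e j vQ '' ⋃₀ (ofComparison n lat sig split qData R hq hadm hfin).possibleImages j vQ) ∧
      Literature.IUT.LogVolume.IsNondegenerate (R.K j vQ)
        (R.e j vQ '' ⋃₀ (ofComparison n lat sig split qData R hq hadm hfin).possibleImages j vQ) :=
  Iff.rfl

end

end Setting

end Summit.ABC.IUTFork.Cor312

end
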